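import Mathlib
import Literature.Computability.AlgebraicComplexity.BirkhoffShadow
import Literature.Computability.AlgebraicComplexity.BirkhoffShadowProofs
import Literature.Computability.AlgebraicComplexity.BirkhoffShadowLowerBound

/-!
# `DivisionGap.ShadowBirkhoff` (stmt-ValiantsHypothesis-5069), line `parabola-register-face` —
# stub `stub_faceVertices`

Certification step of the line: the equality points of a dominated face are shadow vertices of the
Birkhoff polytope `DS_N`.

Data: a pattern `G ⊆ [N]²`, weight tables `wb, wa` (along a permutation `ρ` write
`b(ρ) = Σ_u wb(u, ρ u)`, `a(ρ) = Σ_u wa(u, ρ u)`), a function `φ` with a "subgradient selection"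
`ψ` in the strict sense `φ t + ψ t · (s − t) < φ s` for `s ≠ t`, and domination `φ(b ρ) ≤ a ρ` along
every permutation supported in `G`.  Conclusion (`stub_faceVertices`): for a suitable linear
`L : ℝ^{N×N} → ℝ²` the number of *equality values* `t` (some supported `ρ` has `b ρ = t` and
`a ρ = φ t`) is at most the number of vertices of the shadow `L(DS_N)`
(`birkhoffShadowVertexCount L`).

Proof.  Choose a penalty `P ≥ 0` exceeding the finitely many numbers
`φ(b ρ₀) − ψ(b ρ₀)·b ρ₀ + ψ(b ρ₀)·b ρ − a ρ` and put
`L = BirkhoffShadowLower.Lmap (fun u v => (wb u v, wa u v + P·[(u, v) ∉ G]))`; on the permutation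
matrix of `ρ` it evaluates to `![b ρ, a ρ + Σ_u P·[(u, ρ u) ∉ G]]` (`Lmap_perm_eq`).  For an
equality value `t` (witness `ρ₀`) the point `![t, φ t] = L(matrix ρ₀)` is the unique maximiser over
the projected permutation matrices of the continuous linear functional `y ↦ ψ(t)·y 0 − y 1`
(strictness of the subgradient inequality for supported `ρ` with `b ρ ≠ t`; domination and `y ≠ z`
for supported `ρ` with `b ρ = t`; the penalty for unsupported `ρ`), hence an extreme point of the
shadow (`BirkhoffShadowLower.mem_extremePoints_convexHull_of_forall_lt`).  Distinct `t` give
distinct points, the extreme points form a finite set (`extremePoints_convexHull_subset`), and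
`Set.ncard_le_ncard_of_injOn` concludes.
-/

set_option linter.dupNamespace false

noncomputable section

open scoped BigOperators

namespace Summit.ValiantsHypothesis.ValiantsHypothesis.Theorems.DivisionGapShadowBirkhoff

open Literature.Computability.AlgebraicComplexity

/-- A real-valued function on a finite type is strictly bounded above by a nonnegative real
(`1 + Σ |f|`). [folklore] -/
theorem faceVertices_exists_nonneg_forall_lt {ι : Type*} [Fintype ι] (f : ι → ℝ) :
    ∃ P : ℝ, 0 ≤ P ∧ ∀ i, f i < P := by
  refine ⟨1 + ∑ i, |f i|, by positivity, fun i => ?_⟩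
  have h1 : f i ≤ |f i| := le_abs_self _
  have h2 : |f i| ≤ ∑ j, |f j| :=
    Finset.single_le_sum (fun j _ => abs_nonneg (f j)) (Finset.mem_univ i)
  linarith

/-- **Certification: equality points of a dominated face are shadow vertices of `DS_N`.**
If `φ(b(ρ)) ≤ a(ρ)` along every permutation supported in `G` (with `φ` admitting the strict
subgradient selection `ψ`), then for a suitable linear `L : ℝ^{N×N} → ℝ²` the number of values
`t = b(ρ)` of supported `ρ` with `a(ρ) = φ t` is at most the number of vertices of the shadow
`L(DS_N)`.  `L = BirkhoffShadowLower.Lmap (fun u v => (wb u v, wa u v + P·[(u,v) ∉ G]))` with a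
penalty `P` larger than the finitely many defects; for an equality value `t` the point `![t, φ t]`
is the unique maximiser of `y ↦ ψ(t)·y 0 − y 1` over the projected permutation matrices, hence
extreme; distinct `t` give distinct points. [folklore] -/
theorem stub_faceVertices {N : ℕ} (G : Finset (Fin N × Fin N)) (wb wa : Fin N → Fin N → ℝ)
    (φ ψ : ℝ → ℝ) (hφ : ∀ s t : ℝ, s ≠ t → φ t + ψ t * (s - t) < φ s)
    (hdom : ∀ ρ : Equiv.Perm (Fin N), (∀ u, (u, ρ u) ∈ G) →
      φ (∑ u, wb u (ρ u)) ≤ ∑ u, wa u (ρ u)) :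
    ∃ L : (Fin N × Fin N → ℝ) →ₗ[ℝ] (Fin 2 → ℝ),
      {t : ℝ | ∃ ρ : Equiv.Perm (Fin N), (∀ u, (u, ρ u) ∈ G) ∧
          ∑ u, wb u (ρ u) = t ∧ ∑ u, wa u (ρ u) = φ t}.ncard ≤
        Literature.Computability.AlgebraicComplexity.birkhoffShadowVertexCount L := by
  classical
  -- a penalty exceeding the finitely many defects
  obtain ⟨P, hP0, hP⟩ : ∃ P : ℝ, 0 ≤ P ∧ ∀ p : Equiv.Perm (Fin N) × Equiv.Perm (Fin N),
      φ (∑ u, wb u (p.2 u)) - ψ (∑ u, wb u (p.2 u)) * ∑ u, wb u (p.2 u)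
        + ψ (∑ u, wb u (p.2 u)) * ∑ u, wb u (p.1 u) - ∑ u, wa u (p.1 u) < P :=
    faceVertices_exists_nonneg_forall_lt _
  -- the weights of the linear map: slope `wb`, intercept `wa` plus the penalty off the pattern
  obtain ⟨v, hv⟩ : ∃ v : Fin N → Fin N → ℝ × ℝ,
      ∀ u w, v u w = (wb u w, wa u w + if (u, w) ∈ G then 0 else P) := ⟨_, fun _ _ => rfl⟩
  refine ⟨BirkhoffShadowLower.Lmap v, ?_⟩
  -- the two coordinates of `Lmap v` on the permutation matrix of `ρ`
  have hfst : ∀ ρ : Equiv.Perm (Fin N), (∑ u, v u (ρ u)).1 = ∑ u, wb u (ρ u) := by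
    intro ρ
    rw [Prod.fst_sum]
    simp only [hv]
  have hsnd : ∀ ρ : Equiv.Perm (Fin N), (∑ u, v u (ρ u)).2 =
      ∑ u, wa u (ρ u) + ∑ u, (if (u, ρ u) ∈ G then (0 : ℝ) else P) := by
    intro ρ
    rw [Prod.snd_sum, ← Finset.sum_add_distrib]
    simp only [hv]
  -- no penalty on supported permutations, penalty at least `P` on the others
  have hpen0 : ∀ ρ : Equiv.Perm (Fin N), (∀ u, (u, ρ u) ∈ G) →
      ∑ u, (if (u, ρ u) ∈ G then (0 : ℝ) else P) = 0 := fun ρ hρ =>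
    Finset.sum_eq_zero fun u _ => if_pos (hρ u)
  have hpenP : ∀ ρ : Equiv.Perm (Fin N), (¬ ∀ u, (u, ρ u) ∈ G) →
      P ≤ ∑ u, (if (u, ρ u) ∈ G then (0 : ℝ) else P) := by
    intro ρ hρ
    push Not at hρ
    obtain ⟨u₀, hu₀⟩ := hρ
    calc P = (if (u₀, ρ u₀) ∈ G then (0 : ℝ) else P) := by rw [if_neg hu₀]
      _ ≤ ∑ u, (if (u, ρ u) ∈ G then (0 : ℝ) else P) :=
        Finset.single_le_sum (f := fun u => if (u, ρ u) ∈ G then (0 : ℝ) else P)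
          (fun u _ => by positivity) (Finset.mem_univ u₀)
  -- the projected permutation matrices form a finite set
  set S : Set (Fin 2 → ℝ) := BirkhoffShadowLower.Lmap v '' permMatrixPoints N with hS
  have hfin : S.Finite := by
    rw [hS, HrubesYehudayoff2021Prop23.image_permMatrixPoints_eq_range]
    exact Set.finite_range _
  -- the touching point of the equality value `t`
  obtain ⟨z, hz⟩ : ∃ z : ℝ → (Fin 2 → ℝ), ∀ t, z t = ![t, φ t] := ⟨_, fun _ => rfl⟩
  have hz0 : ∀ t, z t 0 = t := fun t => by simp [hz]
  have hz1 : ∀ t, z t 1 = φ t := fun t => by simp [hz]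
  have hmem : ∀ t ∈ {t : ℝ | ∃ ρ : Equiv.Perm (Fin N), (∀ u, (u, ρ u) ∈ G) ∧
      ∑ u, wb u (ρ u) = t ∧ ∑ u, wa u (ρ u) = φ t},
      z t ∈ (convexHull ℝ S).extremePoints ℝ := by
    rintro t ⟨ρ₀, hρ₀, hb₀, ha₀⟩
    -- the value of `Lmap v` at a supported `ρ` with `b ρ = t`, `a ρ = φ t` is `z t`
    have hval : ∀ ρ : Equiv.Perm (Fin N), (∀ u, (u, ρ u) ∈ G) → ∑ u, wb u (ρ u) = t →
        ∑ u, wa u (ρ u) = φ t →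
        BirkhoffShadowLower.Lmap v
          (fun ij : Fin N × Fin N => if ρ ij.2 = ij.1 then (1 : ℝ) else 0) = z t := by
      intro ρ hρ hb ha
      rw [BirkhoffShadowLower.Lmap_perm_eq, hfst, hsnd, hpen0 ρ hρ, add_zero, hb, ha, hz]
    -- the supporting functional `y ↦ ψ t · y 0 - y 1`
    let l : (Fin 2 → ℝ) →L[ℝ] ℝ :=
      (ψ t) • ContinuousLinearMap.proj (R := ℝ) (φ := fun _ : Fin 2 => ℝ) 0 -
        ContinuousLinearMap.proj (R := ℝ) (φ := fun _ : Fin 2 => ℝ) 1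
    have hl : ∀ y : Fin 2 → ℝ, l y = ψ t * y 0 - y 1 := by
      intro y
      simp [l]
    apply BirkhoffShadowLower.mem_extremePoints_convexHull_of_forall_lt l
    · exact ⟨_, ⟨ρ₀, rfl⟩, hval ρ₀ hρ₀ hb₀ ha₀⟩
    · rintro y ⟨x, ⟨ρ, rfl⟩, rfl⟩ hne
      rw [hl, hl, hz0, hz1, BirkhoffShadowLower.Lmap_perm_eq, hfst, hsnd]
      simp only [Matrix.cons_val_zero, Matrix.cons_val_one]
      have hPρ := hP (ρ, ρ₀)
      simp only [hb₀] at hPρ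
      by_cases hsupp : ∀ u, (u, ρ u) ∈ G
      · rw [hpen0 ρ hsupp, add_zero]
        have hd := hdom ρ hsupp
        by_cases hbt : ∑ u, wb u (ρ u) = t
        · -- same slope value: the intercept is larger, else the points coincide
          have hne' : ∑ u, wa u (ρ u) ≠ φ t := fun h => hne (hval ρ hsupp hbt h)
          rw [hbt] at hd ⊢
          have hlt : φ t < ∑ u, wa u (ρ u) := lt_of_le_of_ne hd (Ne.symm hne')
          linarith
        · -- different slope value: strict subgradient inequality and domination
          have hst := hφ _ t hbt
          linarith
      · -- unsupported: the penalty
        have hpe := hpenP ρ hsupp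
        linarith
  have hinj : Set.InjOn z {t : ℝ | ∃ ρ : Equiv.Perm (Fin N), (∀ u, (u, ρ u) ∈ G) ∧
      ∑ u, wb u (ρ u) = t ∧ ∑ u, wa u (ρ u) = φ t} := by
    intro s _ s' _ h
    have h0 := congrFun h 0
    rwa [hz0, hz0] at h0
  have hfinE : ((convexHull ℝ S).extremePoints ℝ).Finite :=
    hfin.subset extremePoints_convexHull_subset
  exact Set.ncard_le_ncard_of_injOn z hmem hinj hfinE

end Summit.ValiantsHypothesis.ValiantsHypothesis.Theorems.DivisionGapShadowBirkhoff

end
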